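/-
Origin: expansion seat `planner-pub-hodgecm-pv13-g2-0`, handover #1 2026-08-18T05:05:57Z (`HOME/pub-hodgecm-pv13-g2/lean/Pv13/Li92Bridge.lean`, md5 8e8b166f, 514 lines);
landed by the gen-6 packager in gate run 22 as `HodgeCM/PerL34/Li92Bridge.lean` (verbatim).
-/
/-
Origin: pub-hodgecm-pv13-g2 (DAG-NODE PROVER #13, gen 2; session planner-pub-hodgecm-pv13-g2-0) — seam S3 /
node N31h (ii) (PerL v5 tex ll. 632–635) and the N31 leaf of `perL` (Lemma 4.2(b), ll. 529–532), consumed BY NAME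
from the VERBATIM print record `HodgeCM.Literature.Theta.Li92GlobalDatum.StableRangeNonvanishing` = [Li92, J.-S. Li,
J. reine angew. Math. 428 (1992), Corollary 5.5, p. 206] typed by the cited-fact seat cf-kudla-howe-rallis-g2
(`HodgeCM/Literature/ThetaCorrespondence.lean` v3 §11; LEMMAS.md v7 §2 item (3)(b), GAPS.md cfKHRg2-O1 / pv13 add. 13).
Imports: `HodgeCM.Literature.ThetaCorrespondence` (v3, run-22 queue — this file must land AFTER it), the landed
`HodgeCM.PerL34.CharsAssembly`, `HodgeCM.PerL34.EulerProductSmoke` (run 19; the toy `LocalFactorDatum` for the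
non-vacuity section) and `HodgeCM.PerL34.SchurUnitary` (run 20; `Schur.Invariant`).
Proposed place: `HodgeCM/PerL34/Li92Bridge.lean`, namespace `HodgeCM.PerL34.Li92Route`.
Nothing cited as a Lean axiom, nothing asserted: the print theorem enters as the hypothesis FIELD `cor55` whose TYPE is
the Literature seat's verbatim `Prop`; every dictionary sentence is a labelled field (D2 / D4 / D5 / (r1) / (r3));
everything between them is KERNEL.
-/
import Summits.HodgeConjecture.HodgeCM.Literature.ThetaCorrespondence_4
import Summits.HodgeConjecture.HodgeCM.PerL34.CharsAssembly
import Summits.HodgeConjecture.HodgeCM.PerL34.EulerProductSmoke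
import Summits.HodgeConjecture.HodgeCM.PerL34.SchurUnitary

set_option autoImplicit false

/-!
# N31 / N31h (ii) on the Li92 route: Lemma 4.2(b) from [Li92 Cor 5.5] by name

PerL v5, Lemma 4.2(b) (tex ll. 529–532, node N31): "If `(W_i, μ_i)` have the forced signs and infinity type of type
`Ψ_i` (Definition 3.2) and `χ'_i` has infinity type `e(Ψ_i)` (Lemma 4.1(a)), then the theta space
`π_i := Θ^{W_i}_{μ_i}(χ'_i)` is non-zero and every irreducible constituent `σ` of its closure lies in `𝒜^{1,0}` …;
i.e. `(W_i, μ_i, χ'_i)` is allowed."  Its proof's last sentence (ll. 632–635, node N31h (ii)): "Finally, `π_i` is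
generated by the `θ(φ,χ'_i)` with `φ_b` in the isotypic parts singled out in (a), which realise `J⁺` at `ι₁` and `𝟏`
at `b ≠ ι₁` as `(𝔤_b,K_b)`-modules [Y1neg, Lemmas 3.1, 3.2]; so every irreducible constituent of the closure of `π_i`
has archimedean component `J⁺ ⊗ 𝟏^⊗`, i.e. lies in `𝒜^{1,0}`."  ([Y1neg] is under adjudication, not citable.)

PRINT, verbatim (cf-kudla-howe-rallis-g2, page-verified on `lit/Li92-crelle428/img_00000210.jpg`; also pv13 gen 1,
GAPS add. 13): [Li92, **Corollary 5.5**, p. 206] "Suppose `n > 2n' + 4ε − 2`.  Let `S_∞ ⊆ S` be the set of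
archimedean places of `k`.  Assume that `π_v` is a discrete series representation for each `v ∈ S_∞`.  Then
`V(θ, π) ≠ 0` if and only if `H(π_v) ≠ 0` for each `v ∈ S_∞`.  In that case it affords an irreducible unitary
representation of `G̃(𝔸)`.  Write `σ = ⊗ σ_v` for this representation.  Then for every place `v` we have
`σ_v → π_v*` under Howe's correspondence."  Typed as `Li92GlobalDatum.StableRangeNonvanishing` (field `cor55` below).

DICTIONARY (each a labelled FIELD; PerL makes the identification itself at tex ll. 604–605 when it cites [Li92
Thm 2.1]: "Li's case 2, `ε = 1/2`, `(n,n') = (3,1)`, `n > 2n'+4ε−2 = 2`"):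
* D4 `n_eq … d₀_eq`: `(G, G') = (U(V₃), U(W_i))`, `D = L`, `D₀ = L₀`, so `(n, n', d, d₀) = (3, 1, 2, 1)`; hence Li's range
  condition is a THEOREM (`LineDict.convergentRange`, `norm_num`);
* D4 `cusp`: the character `χ'_i` of `[U(W_i)]` (the `i`-th factor of the pair character `χ = χ'₁ ⊠ χ'₂ : D.X`, kernel
  factorisation `MonoidHom.existsUnique_prod_factor` in `CharsAssembly`) read as a genuine cusp form on `Ũ(W_i)(𝔸)` via
  the `(χ_V, μ_i)`-splitting ([HKS]; the same dictionary item N31b–N31e use for [Li92 Thm 2.1]; `U(W_i)` is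
  anisotropic, so every automorphic form on it is cuspidal);
* D4 `ds_arch`: `U(W_i)(L_{0,b}) = U(1)` is COMPACT at every archimedean `b` (L is CM), so every `χ'_{i,b}` is a
  discrete series representation (definitional);
* D2 `Ambient.act`: the right translations `R(g)`, `g ∈ G_U(𝔸)`, on `L²([G_U])`; D2 `Ambient.InA10 K`: "the closed
  invariant subspace `K ⊆ L²([G_U])` is (the space of) an irreducible automorphic representation lying in `𝒜^{1,0}`",
  i.e. of archimedean component `J⁺` at `ι₁` and the trivial-type representation at the definite places (tex §1.2 /
  §2; [BW] VI Thm 4.11, VII Prop 4.11 as used in PerL §3.1) — an OPAQUE predicate, exactly as opaque as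
  `TorusData.allowed`, which it refines;
* D4/D2 `Theta χ` = PerL's generating set `{θ(φ, χ'_i) : φ ∈ 𝒮}` of `π_i` (tex l. 266, ll. 340–345) inside `L²([G_U])`,
  `Vθ χ` = Li's `V(θ, χ'_i)` = the span of ALL lifts `θ^f_φ`, `φ ∈ S(X(𝔸))`, `f ∈ π` ([Li92] (4), p. 178; p. 204 l. 3–5);
  `Theta_sub` (PerL's lifts are among Li's: `𝒮 ⊆ S(X(𝔸))`, `f = χ'_i`), `Vθ_le` (conversely `V(θ,χ'_i)` lies in the
  `L²`-closure of `π_i`: density of the `K_∞`-finite Schwartz space `𝒮` in `S(X(𝔸))`, tex ll. 341–349 = node N18, and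
  `L²`-continuity of `φ ↦ θ(φ,χ')` on the compact `[U(W_i)]`; cf. GAPS cfKHRg2 MISMATCH (iii) "the two spans have the
  same closure"), `Vθ_inv` (`R(g) θ^f_φ = θ^f_{ω(g)φ}`: `V(θ,π)` is `G(𝔸)`-stable — Li p. 204), `thetaNe_iff` ("`V(θ,π) ≠ 0`"
  means the subspace is non-zero), `irr_of_thetaIrr` ("affords an irreducible unitary representation of `G̃(𝔸)`" =
  its `L²`-closure has no closed `G(𝔸)`-invariant subspaces other than `0` and itself);
* (r1) `inA10_of_howe` — THE ONE PerL-SPECIFIC ARCHIMEDEAN INPUT, NOT discharged here: Cor 5.5's last sentence gives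
  `σ_b → (χ'_{i,b})*` under Howe's correspondence at every archimedean `b`; PerL Lemma 4.1(a), second clause (tex
  ll. 480–482: "conversely for such `χ'_i` the archimedean theta lifts are `J⁺` at `ι₁` and `𝟏` elsewhere"; proof
  l. 494–495 "the converse is the definition of `φ⁰_{i,b}`", existence by the Fock-model computations = nodes N26–N28,
  pv01 `ArchBookkeeping`, pv12 `Fock.N28_kernel`, KERNEL for the polynomial models; PRINT: Howe duality for the
  compact dual pairs `(U(1), U(2,1))`, `(U(1), U(3))` — Kashiwara–Vergne, Invent. Math. 44 (1978); J.-S. Li, Duke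
  Math. J. 61 (1990); K-types [BW] VIII 2.10/2.14) identifies these Howe correspondents as `J⁺` at `ι₁` and `𝟏` at
  `b ≠ ι₁` for `χ'_i` of infinity type `e(Ψ_i)` (the type carried by `D.X`), with the contragredient/sign convention of
  GAPS cfKHRg2-N1 (D5); hence the irreducible `σ = closure V(θ,χ'_i)` lies in `𝒜^{1,0}`;
* (r3) `SideDict.allowed_of` — Definition 3.2 VERBATIM (tex ll. 274–278: "An *allowed datum of type `Ψ_i`* is a
  triple `(W_i, μ_i, χ'_i)`: … such that the theta space `π_i := Θ^{W_i}_{μ_i}(χ'_i)` is non-zero and every irreducible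
  constituent of its `L²`-closure lies in `𝒜^{1,0}`.  An *allowed pair of type (12)* is a pair of allowed data of
  types `Ψ_1, Ψ_2` with `μ_1 μ_2 = μ_W`; likewise for (34)") read into the interface predicate `TorusData.allowed χ` =
  "`χ = χ'₁ ⊠ χ'₂` arises from an allowed pair" (Perl34.lean ll. 190–195; lines and splitting characters are fixed),
  with "irreducible constituent of the closure" the DEFINED predicate `Ambient.IsConstituent` (D5 is a definition
  here, not a field).

KERNEL (this file): Li's range holds for PerL's parameters; `closure π_i = closure V(θ,χ'_i)`; Cor 5.5 ⇒ (thetaNe ⇒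
irreducible + Howe at every place); irreducibility ⇒ the closure of `π_i` has EXACTLY ONE irreducible constituent,
itself (so "every irreducible constituent lies in `𝒜^{1,0}`" is the single instance (r1)); Def 3.2 ⇒ allowed.  Two
routes to `thetaNe`:
* ROUTE A (PerL v5 AS WRITTEN): `θ_φ(χ'_i) ≠ 0` is the KERNEL theorem N31h (i) (`LocalFactorDatum.theta_ne_zero`, from
  the Rallis chain N31b–N31g), and `θ_φ(χ'_i) ∈ V(θ,χ'_i)` (field `fst_mem/snd_mem`, definitional) — only Cor 5.5's
  SECOND clause is used; output `AnalyticSide.toSideOutputs : SideOutputs D Pl` with `allowed_of_pair` DERIVED, hence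
  `ClusterOutputs T`, `N31_chars T`, `T.Open_chars` by the landed `CharsAssembly` (`clusterOutputs_of_analytic`).
* ROUTE B (PRINT-ONLY, LEMMAS v7 (2′) "one print leaf"): archimedean occurrence `H(χ'_{i,b}) ≠ 0` (field `occ₁/occ₂` =
  (r1a), PerL L4.2(b) proof first sentence l. 542–543 "at the real places `θ_b(χ'_{i,b})` is `J⁺` resp. `𝟏` by the choice
  of `e(Ψ_i)` (Lemma 4.1(a))" — the same archimedean input as (r1)) and Cor 5.5's FIRST clause give `V(θ,χ'_i) ≠ 0`
  with NO doubling / Siegel–Weil / Rallis / local-factor / Euler-product input (N31b–N31h (i) become Li's printed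
  proof, pp. 181–184, 204–206); output `OccSide.allowed_all`, `open_chars_of_print : PrintInputs T → T.Open_chars`.
NON-VACUITY: `Smoke.*` inhabits every structure over the prior one-point torus (`allowed ≡ True`) with a trivially
true Li-datum of PerL's parameters, and both routes fire.
-/

noncomputable section

namespace HodgeCM
namespace PerL34
namespace Li92Route

open HodgeCM.Prior.Perl34File
open HodgeCM.PerL34.Schur
open HodgeCM.PerL34.EulerProduct
open HodgeCM.Literature.Theta

/-! ### D2: the ambient `L²([G_U])` with its `G_U(𝔸)`-action and the predicate `𝒜^{1,0}`; D5 as a definition -/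

/-- **D2 (dictionary record, per surface datum).**  `act` = the unitary right translations `R(g)`, `g ∈ G_U(𝔸)`, on
`HG = L²([G_U])`; `InA10 K` = "the closed `G_U(𝔸)`-invariant subspace `K` is an irreducible automorphic representation
lying in `𝒜^{1,0}`" (archimedean component `J⁺ ⊠ 𝟏^⊗`; tex §1.2/§2, [BW] VI 4.11 / VII 4.11).  Opaque. -/
structure Ambient (HG : Type*) [NormedAddCommGroup HG] [InnerProductSpace ℂ HG] [CompleteSpace HG] where
  /-- D2: the operators `R(g)`, `g ∈ G_U(𝔸)` -/
  act : Set (HG →L[ℂ] HG)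
  /-- D2: "`K` (irreducible, closed, invariant) lies in `𝒜^{1,0}`" -/
  InA10 : Submodule ℂ HG → Prop

variable {HG : Type*} [NormedAddCommGroup HG] [InnerProductSpace ℂ HG] [CompleteSpace HG]

namespace Ambient

/-- **D5 as a DEFINITION** ("irreducible constituent of the closure of `π_i`", tex l. 278, l. 634): a non-zero CLOSED
`G_U(𝔸)`-invariant subspace `K` of `P` which is topologically irreducible (its only closed invariant subspaces are `0`
and `K`). -/
def IsConstituent (A : Ambient HG) (P K : Submodule ℂ HG) : Prop :=
  K ≤ P ∧ IsClosed (K : Set HG) ∧ Invariant A.act K ∧ K ≠ ⊥ ∧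
    ∀ K' : Submodule ℂ HG, K' ≤ K → IsClosed (K' : Set HG) → Invariant A.act K' → K' = ⊥ ∨ K' = K

/-- **Definition 3.2, one line, as a `Prop` over the ambient** (tex ll. 277–279): the theta space `π := span Θ` is
non-zero and every irreducible constituent of its closure lies in `𝒜^{1,0}`. -/
def LineAllowed (A : Ambient HG) (Θ : Set HG) : Prop :=
  Submodule.span ℂ Θ ≠ ⊥ ∧
    ∀ K : Submodule ℂ HG, A.IsConstituent (Submodule.span ℂ Θ).topologicalClosure K → A.InA10 K

end Ambient

omit [CompleteSpace HG] in
/-- The closure of the zero subspace is zero (Hausdorff). -/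
theorem topologicalClosure_bot_eq : (⊥ : Submodule ℂ HG).topologicalClosure = ⊥ :=
  le_bot_iff.mp (Submodule.topologicalClosure_minimal ⊥ le_rfl (by
    rw [Submodule.bot_coe]; exact isClosed_singleton))

omit [CompleteSpace HG] in
/-- A subspace whose closure contains a non-zero subspace is non-zero. -/
theorem ne_bot_of_le_closure {P Q : Submodule ℂ HG} (hQ : Q ≠ ⊥) (hle : Q ≤ P.topologicalClosure) : P ≠ ⊥ := by
  rintro rfl
  rw [topologicalClosure_bot_eq, le_bot_iff] at hle
  exact hQ hle

/-! ### D4 + PRINT: one line `W_i` of a side, on Li's carriers -/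

/-- **Dictionary + print record for ONE line `W_i` and its characters `χ'_i`** (see the module docstring for the
label and source of every field).  `X` = the pair characters `χ` of the side's torus of the side's archimedean type
(`TorusData.X`); the line's character is the `i`-th factor of `χ`. -/
structure LineDict (A : Ambient HG) (X : Type) where
  /-- Li's carriers for the dual pair `(G, G') = (U(V₃), U(W_i))` over `k = L₀` ([Li92] §5) -/
  G : Li92GlobalDatum.{0}
  /-- **PRINT [Li92 Cor 5.5, p. 206]**, verbatim `Prop` of the Literature seat -/
  cor55 : G.StableRangeNonvanishing
  /-- D4 (tex ll. 604–605): `n = dim_L V₃ = 3` -/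
  n_eq : G.n = 3
  /-- D4: `n' = dim_L W_i = 1` -/
  n'_eq : G.n' = 1
  /-- D4: `d = [L : L₀] = 2` -/
  d_eq : G.d = 2
  /-- D4: `d₀ = dim_{L₀} L₀ = 1` (`ε = d₀/d = 1/2`, Li's case 2) -/
  d₀_eq : G.d₀ = 1
  /-- D4: `χ ↦ χ'_i` as a genuine cusp form on `Ũ(W_i)(𝔸)` (splitting `(χ_V, μ_i)`) -/
  cusp : X → G.Cusp
  /-- D4 (definitional): `U(W_i)(L_{0,b}) = U(1)` compact ⇒ every `χ'_{i,b}` is discrete series -/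
  ds_arch : ∀ χ : X, ∀ v ∈ G.arch, G.ds v (G.loc (cusp χ) v)
  /-- D2: PerL's generators `{θ(φ,χ'_i) : φ ∈ 𝒮}` of `π_i` in `L²([G_U])` (tex l. 266, ll. 340–345) -/
  Theta : X → Set HG
  /-- D4: Li's `V(θ, χ'_i) ⊆ L²([G_U])` ([Li92] (4), p. 204) -/
  Vθ : X → Submodule ℂ HG
  /-- D4 (definitional): PerL's lifts are among Li's (`𝒮 ⊆ S(X(𝔸))`, `f = χ'_i`) -/
  Theta_sub : ∀ χ, Theta χ ⊆ Vθ χ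
  /-- D4 (tex ll. 341–349 = N18 density + `L²`-continuity of `φ ↦ θ(φ,χ')`): `V(θ,χ'_i) ⊆ closure π_i` -/
  Vθ_le : ∀ χ, Vθ χ ≤ (Submodule.span ℂ (Theta χ)).topologicalClosure
  /-- D4 ([Li92] p. 204): `V(θ,π)` is `G(𝔸)`-stable -/
  Vθ_inv : ∀ χ, Invariant A.act (Vθ χ)
  /-- D4: "`V(θ, π) ≠ 0`" -/
  thetaNe_iff : ∀ χ, G.thetaNe (cusp χ) ↔ Vθ χ ≠ ⊥
  /-- D4: "`V(θ,π)` affords an irreducible unitary representation of `G̃(𝔸)`" = its closure is topologically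
  irreducible under `G(𝔸)` -/
  irr_of_thetaIrr : ∀ χ, G.thetaIrr (cusp χ) → ∀ K : Submodule ℂ HG, K ≤ (Vθ χ).topologicalClosure →
    IsClosed (K : Set HG) → Invariant A.act K → K = ⊥ ∨ K = (Vθ χ).topologicalClosure
  /-- **(r1) — PerL Lemma 4.1(a) second clause + [BW]/Howe-duality print + D5 sign (NOT discharged here)**: if
  `σ = closure V(θ,χ'_i)` is irreducible with `σ_b → (χ'_{i,b})*` under Howe's correspondence at every archimedean `b`,
  then `σ` lies in `𝒜^{1,0}` (its archimedean component is `J⁺ ⊠ 𝟏^⊗` for `χ'_i` of infinity type `e(Ψ_i)`). -/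
  inA10_of_howe : ∀ χ, G.thetaIrr (cusp χ) → (∀ v ∈ G.arch, G.howe (cusp χ) v) →
    A.InA10 (Vθ χ).topologicalClosure

namespace LineDict

variable {A : Ambient HG} {X : Type} (ℓ : LineDict A X)

/-- **KERNEL (D4 ⇒ Li's hypothesis):** `n > 2n' + 4ε − 2` for `(n, n', d, d₀) = (3, 1, 2, 1)`: `3 > 2`. -/
theorem convergentRange : ℓ.G.convergentRange := by
  unfold Li92GlobalDatum.convergentRange
  rw [ℓ.n_eq, ℓ.n'_eq, ℓ.d_eq, ℓ.d₀_eq]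
  norm_num

/-- **KERNEL:** `closure π_i = closure V(θ, χ'_i)`. -/
theorem closure_span_eq (χ : X) :
    (Submodule.span ℂ (ℓ.Theta χ)).topologicalClosure = (ℓ.Vθ χ).topologicalClosure :=
  le_antisymm (Submodule.topologicalClosure_mono (Submodule.span_le.mpr (ℓ.Theta_sub χ)))
    (Submodule.topologicalClosure_minimal _ (ℓ.Vθ_le χ) (Submodule.isClosed_topologicalClosure _))

/-- **[Li92 Cor 5.5], second and third sentences, for PerL's line** (kernel application of the print field):
`V(θ,χ'_i) ≠ 0` ⇒ irreducible, with `σ_v → (χ'_{i,v})*` at every place. -/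
theorem irr_howe_of_thetaNe (χ : X) (hne : ℓ.G.thetaNe (ℓ.cusp χ)) :
    ℓ.G.thetaIrr (ℓ.cusp χ) ∧ ∀ v : ℓ.G.Pl, ℓ.G.howe (ℓ.cusp χ) v :=
  (ℓ.cor55 ℓ.convergentRange (ℓ.cusp χ) (ℓ.ds_arch χ)).2 hne

/-- **[Li92 Cor 5.5], first sentence ("if"), for PerL's line:** archimedean occurrence ⇒ `V(θ,χ'_i) ≠ 0`. -/
theorem thetaNe_of_occ (χ : X) (hocc : ∀ v ∈ ℓ.G.arch, ℓ.G.occ v (ℓ.G.loc (ℓ.cusp χ) v)) :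
    ℓ.G.thetaNe (ℓ.cusp χ) :=
  (ℓ.cor55 ℓ.convergentRange (ℓ.cusp χ) (ℓ.ds_arch χ)).1.mpr hocc

/-- **[Li92 Cor 5.5], first sentence ("only if"):** `V(θ,χ'_i) ≠ 0` ⇒ archimedean occurrence (PerL L4.1(a) first
clause, node N27, is PerL's own form). -/
theorem occ_of_thetaNe (χ : X) (hne : ℓ.G.thetaNe (ℓ.cusp χ)) :
    ∀ v ∈ ℓ.G.arch, ℓ.G.occ v (ℓ.G.loc (ℓ.cusp χ) v) :=
  (ℓ.cor55 ℓ.convergentRange (ℓ.cusp χ) (ℓ.ds_arch χ)).1.mp hne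

/-- A non-zero vector of `V(θ,χ'_i)` makes it non-zero in Li's sense (used on route A with `θ_φ(χ'_i)`). -/
theorem thetaNe_of_mem (χ : X) {θ : HG} (hθ : θ ∈ ℓ.Vθ χ) (hθ0 : θ ≠ 0) : ℓ.G.thetaNe (ℓ.cusp χ) := by
  refine (ℓ.thetaNe_iff χ).mpr ?_
  intro h
  rw [h] at hθ
  exact hθ0 ((Submodule.mem_bot ℂ).mp hθ)

/-- **KERNEL — the one-constituent step (tex l. 634 "every irreducible constituent of the closure of `π_i`"):** if
`V(θ,χ'_i) ≠ 0` then the irreducible constituents of `closure π_i` are exactly ONE subspace, `closure V(θ,χ'_i)`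
itself. -/
theorem constituent_eq (χ : X) (hne : ℓ.G.thetaNe (ℓ.cusp χ)) (K : Submodule ℂ HG)
    (hK : A.IsConstituent (Submodule.span ℂ (ℓ.Theta χ)).topologicalClosure K) :
    K = (ℓ.Vθ χ).topologicalClosure := by
  obtain ⟨hle, hcl, hinv, hne', -⟩ := hK
  rw [ℓ.closure_span_eq χ] at hle
  rcases ℓ.irr_of_thetaIrr χ (ℓ.irr_howe_of_thetaNe χ hne).1 K hle hcl hinv with h | h
  · exact absurd h hne'
  · exact h

/-- **Definition 3.2's clause for the line, from `V(θ,χ'_i) ≠ 0`** (kernel; inputs: print `cor55`, dictionary, (r1)). -/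
theorem lineAllowed_of_thetaNe (χ : X) (hne : ℓ.G.thetaNe (ℓ.cusp χ)) : A.LineAllowed (ℓ.Theta χ) := by
  refine ⟨ne_bot_of_le_closure ((ℓ.thetaNe_iff χ).mp hne) (ℓ.Vθ_le χ), fun K hK => ?_⟩
  rw [ℓ.constituent_eq χ hne K hK]
  obtain ⟨hirr, hhowe⟩ := ℓ.irr_howe_of_thetaNe χ hne
  exact ℓ.inA10_of_howe χ hirr fun v _ => hhowe v

/-- **Route B for the line:** archimedean occurrence ⇒ Definition 3.2's clause. -/
theorem lineAllowed_of_occ (χ : X) (hocc : ∀ v ∈ ℓ.G.arch, ℓ.G.occ v (ℓ.G.loc (ℓ.cusp χ) v)) :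
    A.LineAllowed (ℓ.Theta χ) :=
  ℓ.lineAllowed_of_thetaNe χ (ℓ.thetaNe_of_occ χ hocc)

/-- **Local occurrence EVERYWHERE** ([Li92 Thm 5.4 a) + the displayed sentence p. 206], node N31a at all places at
once), if the Literature seat's second record is also supplied: not needed for Lemma 4.2(b), recorded for N31a. -/
theorem occ_everywhere (hloc : ℓ.G.StableRangeLocal) (χ : X)
    (hocc : ∀ v ∈ ℓ.G.arch, ℓ.G.occ v (ℓ.G.loc (ℓ.cusp χ) v)) (v : ℓ.G.Pl) :
    ℓ.G.occ v (ℓ.G.loc (ℓ.cusp χ) v) :=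
  hloc.occ_everywhere ℓ.convergentRange hocc v

end LineDict

/-! ### A side (two lines) and Definition 3.2 -/

section Side

variable {H CG G SK SigIdx SigIdxG : Type*}
variable [NormedAddCommGroup H] [InnerProductSpace ℂ H] [CompleteSpace H]
variable [NormedAddCommGroup CG] [NormedSpace ℂ CG]
variable [Group G] [TopologicalSpace G] [TopologicalSpace SK]
variable {C : Perl34.IsolationCore H HG CG G SK SigIdx SigIdxG}

/-- **The Li92 dictionary of a torus SIDE** (`T = U(W₁) × U(W₂)`, resp. `T'`): one line dictionary per line, over the
same ambient `L²([G_U])`, and Definition 3.2 read into the interface predicate. -/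
structure SideDict (A : Ambient HG) (D : Perl34.TorusData C) where
  /-- the line `W₁` (resp. `W₃`) and the first factor `χ'₁` of `χ` -/
  line₁ : LineDict A D.X
  /-- the line `W₂` (resp. `W₄`) and the second factor `χ'₂` of `χ` -/
  line₂ : LineDict A D.X
  /-- **(r3) Definition 3.2 VERBATIM** (tex ll. 274–278, quoted in the module docstring) + `TorusData.allowed χ` =
  "`χ = χ'₁ ⊠ χ'₂` arises from an allowed pair" (Perl34.lean ll. 190–195): both lines' data allowed ⇒ `χ` allowed. -/
  allowed_of : ∀ χ : D.X, A.LineAllowed (line₁.Theta χ) → A.LineAllowed (line₂.Theta χ) → D.allowed χ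

namespace SideDict

variable {A : Ambient HG} {D : Perl34.TorusData C} (S : SideDict A D)

/-- **Lemma 4.2(b) for the pair character `χ`, from `V(θ,χ'₁) ≠ 0` and `V(θ,χ'₂) ≠ 0`.** -/
theorem allowed_of_thetaNe (χ : D.X) (h₁ : S.line₁.G.thetaNe (S.line₁.cusp χ))
    (h₂ : S.line₂.G.thetaNe (S.line₂.cusp χ)) : D.allowed χ :=
  S.allowed_of χ (S.line₁.lineAllowed_of_thetaNe χ h₁) (S.line₂.lineAllowed_of_thetaNe χ h₂)

/-- **Route B, per character:** archimedean occurrence on both lines ⇒ `χ` allowed. -/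
theorem allowed_of_occ (χ : D.X)
    (h₁ : ∀ v ∈ S.line₁.G.arch, S.line₁.G.occ v (S.line₁.G.loc (S.line₁.cusp χ) v))
    (h₂ : ∀ v ∈ S.line₂.G.arch, S.line₂.G.occ v (S.line₂.G.loc (S.line₂.cusp χ) v)) : D.allowed χ :=
  S.allowed_of_thetaNe χ (S.line₁.thetaNe_of_occ χ h₁) (S.line₂.thetaNe_of_occ χ h₂)

end SideDict

/-- **ROUTE B inputs for a side: the dictionary + (r1a) archimedean occurrence** (PerL L4.2(b) proof, first sentence,
tex l. 542–543: "at the real places `θ_b(χ'_{i,b})` is `J⁺` resp. `𝟏` by the choice of `e(Ψ_i)` (Lemma 4.1(a))"; i.e.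
`H(χ'_{i,b}) ≠ 0` for `χ'_i` of infinity type `e(Ψ_i)` — Fock model, nodes N26–N28; sign convention GAPS cfKHRg2-N1). -/
structure OccSide (A : Ambient HG) (D : Perl34.TorusData C) extends SideDict A D where
  /-- (r1a) archimedean occurrence for the first line -/
  occ₁ : ∀ χ : D.X, ∀ v ∈ line₁.G.arch, line₁.G.occ v (line₁.G.loc (line₁.cusp χ) v)
  /-- (r1a) archimedean occurrence for the second line -/
  occ₂ : ∀ χ : D.X, ∀ v ∈ line₂.G.arch, line₂.G.occ v (line₂.G.loc (line₂.cusp χ) v)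

/-- **ROUTE B — Lemma 4.2(b) for the side in the consumed form, with NO analytic (N31b–N31h (i)) input:** every
character of `[T]` of type `w` is allowed. -/
theorem OccSide.allowed_all {A : Ambient HG} {D : Perl34.TorusData C} (S : OccSide A D) :
    ∀ χ : D.X, D.allowed χ :=
  fun χ => S.toSideDict.allowed_of_occ χ (S.occ₁ χ) (S.occ₂ χ)

/-- **ROUTE A inputs for a side (PerL v5 as written): the dictionary + the two local-factor data of the proof**
(nodes N31d–N31g outputs, `LocalFactorDatum`, whose `theta_ne_zero` is the KERNEL theorem N31h (i)) + the
definitional membership `θ_φ(χ'_i) ∈ V(θ, χ'_i)`. -/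
structure AnalyticSide (A : Ambient HG) (D : Perl34.TorusData C) (Pl : Type) extends SideDict A D where
  /-- the proof's datum for the first line (as in `SideOutputs.fst`) -/
  fst : D.X → LocalFactorDatum Pl HG
  /-- the proof's datum for the second line -/
  snd : D.X → LocalFactorDatum Pl HG
  /-- D4 (definitional): `θ_φ(χ'₁)` is one of Li's lifts `θ^f_φ` -/
  fst_mem : ∀ χ : D.X, (fst χ).theta ∈ line₁.Vθ χ
  /-- D4 (definitional): `θ_φ(χ'₂)` is one of Li's lifts -/
  snd_mem : ∀ χ : D.X, (snd χ).theta ∈ line₂.Vθ χ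

namespace AnalyticSide

variable {A : Ambient HG} {D : Perl34.TorusData C} {Pl : Type}

/-- **ROUTE A — the landed two-line package `SideOutputs` with its residual field `allowed_of_pair` DERIVED:**
non-vanishing of both lifts (hypotheses of the field; theorems by N31h (i)) ⇒ `V(θ,χ'_j) ≠ 0` ⇒ [Cor 5.5] irreducible
with Howe correspondents ⇒ (r1) in `𝒜^{1,0}` ⇒ [one constituent, Def 3.2] allowed. -/
def toSideOutputs (S : AnalyticSide A D Pl) : SideOutputs D Pl where
  fst := S.fst
  snd := S.snd
  allowed_of_pair χ h₁ h₂ :=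
    S.toSideDict.allowed_of_thetaNe χ (S.line₁.thetaNe_of_mem χ (S.fst_mem χ) h₁)
      (S.line₂.thetaNe_of_mem χ (S.snd_mem χ) h₂)

/-- Lemma 4.2(b) for the side (route A). -/
theorem allowed_all (S : AnalyticSide A D Pl) : ∀ χ : D.X, D.allowed χ :=
  S.toSideOutputs.allowed_all

/-- The one-line residual `ConstituentHalf` of `EulerProduct` for the first line, now DERIVED (route A). -/
theorem constituentHalf_fst (S : AnalyticSide A D Pl) : ConstituentHalf D S.fst :=
  S.toSideOutputs.constituentHalf_fst

/-- The prior / carver `CharsDischarge` package of the side (route A). -/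
def charsDischarge (S : AnalyticSide A D Pl) : Perl34.C4.CharsDischarge D Pl :=
  S.toSideOutputs.charsDischarge

/-- On route A, Li's "only if" recovers archimedean occurrence from the KERNEL non-vanishing N31h (i) (consistency
with route B's input (r1a)). -/
theorem occ_arch_fst (S : AnalyticSide A D Pl) (χ : D.X) :
    ∀ v ∈ S.line₁.G.arch, S.line₁.G.occ v (S.line₁.G.loc (S.line₁.cusp χ) v) :=
  S.line₁.occ_of_thetaNe χ (S.line₁.thetaNe_of_mem χ (S.fst_mem χ) (S.fst χ).theta_ne_zero)

end AnalyticSide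

end Side

/-! ### Model level: `ClusterOutputs T` (route A) and `T.Open_chars` (route B) by name -/

section Model

variable {U : Universe} (T : U.ThetaModel)

/-- **Route A inputs for the model:** in every good context, an ambient dictionary for `L²([G_U])` and analytic side
data for both torus sides. -/
def AnalyticInputs : Prop :=
  ∀ {L : CMField} {ι₁ : L →+* ℂ} (V : HermSpace3 L ι₁) (c : SeesawCtx L), T.GoodCtx ι₁ c →
    ∃ (A : Ambient (T.HG L ι₁ V)) (Pl : Type),
      Nonempty (AnalyticSide A (T.t12 V c) Pl) ∧ Nonempty (AnalyticSide A (T.t34 V c) Pl)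

/-- **Route B inputs for the model:** in every good context, an ambient dictionary and occurrence side data for both
torus sides (print [Li92 Cor 5.5] + dictionary + (r1)/(r1a) archimedean input; nothing from N31b–N31h). -/
def PrintInputs : Prop :=
  ∀ {L : CMField} {ι₁ : L →+* ℂ} (V : HermSpace3 L ι₁) (c : SeesawCtx L), T.GoodCtx ι₁ c →
    ∃ A : Ambient (T.HG L ι₁ V), Nonempty (OccSide A (T.t12 V c)) ∧ Nonempty (OccSide A (T.t34 V c))


-- port_pkg: scope closed for this part
end Model
end Li92Route
end PerL34
end HodgeCM
end
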